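import Literature.NumberTheory.LFunctions.Zhang2022.RepairGapLemma58Premise
import HarnessLib

/-!
# Zhang (2022), rescue GAP/BED/REQSIDE (D-0124 (4)–(6)): the SCALE LAW of the Lemma 5.8 door — with
# `P = exp 𝓛^{x}` the passage consumes Assumption (A) at strength exactly `𝓛^{−(2x−3)}` (printed `x = 9`: `𝓛⁻¹⁵`)

Topic `Literature/NumberTheory/LFunctions/Zhang2022` (Landau–Siegel audit tree; verdict-neutral).
Y. Zhang, *Discrete mean estimates and the Landau–Siegel zero*, arXiv:2211.02515v1 (2022)
[Zhang2022LandauSiegel] — **an unrefereed manuscript under adjudication; nothing in this file asserts or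
denies its Theorems 1–2, and nothing here is a claim about Landau–Siegel zeros. The programme SEARCHES and
TYPES; no claim about Landau–Siegel zeros, Theorems 1–2 of arXiv:2211.02515 or a repaired Margin232 until a
kernel theorem says so.**

Lemma 5.8 (§5 p. 11: on `α ≤ |s−1| ≤ 10α`, `L(s,χ) = L′(1,χ)(s−1) + O(α₂)`, `α = π/log P = π𝓛⁻⁹` (2.10),
`α₂ = 𝓛⁻¹⁵`) is the only door through which (A) enters the MAIN TERMS (GAP G-31; `RepairGapLemma58Premise`:
at the printed scale the door consumes exactly `‖L(1,χ)‖ ≤ 𝓛⁻¹⁵`). The rescue's exponent bookkeeping (kit LP-3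
j271838; kernel twin `Repair.Gap.ExpTuple`, `RepairGapExponentBudget`) carries the main-order constraint as the DESK
READING «`E ≥ 2x_P − 3`» (`log P = 𝓛^{x_P}`). This file DERIVES that reading from the Taylor step itself, for every
natural scale exponent `x ≥ 2` (so that the disc `‖s−1‖ ≤ Kπ𝓛^{−x}`, `Kπ ≤ 𝓛^{x−1}`, sits inside `‖s−1‖ ≤ 𝓛⁻¹` where
the tree's remainder bound `Lemma58.norm_taylor_two_remainder_le` applies):

* `lemma58_scale_of_norm_le` — SUFFICIENCY: `‖L(1,χ)‖ ≤ 𝓛^{−(2x−3)}` gives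
  `‖L(s,χ) − L′(1,χ)(s−1)‖ ≤ (1 + 16e^{9/2}π²K²)·𝓛^{−(2x−3)}` on `‖s−1‖ ≤ Kπ𝓛^{−x}` — the remainder is
  `8e^{9/2}(1+𝓛)𝓛²‖s−1‖² ≤ 16e^{9/2}π²K²𝓛^{3−2x}`, the same order as the premise;
* `norm_LFunction_one_le_of_lemma58_scale` — NECESSITY: that conclusion on any range containing `s = 1` forces
  `‖L(1,χ)‖ ≤ C𝓛^{−(2x−3)}`;
* `lemma58_scale_of_assumptionAWith` — hence `Repair.Bed.AssumptionAWith E` suffices for every real `E ≥ 2x − 3`;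
* at the printed `x = 9` (`2·9 − 3 = 15`, `Kπ ≤ 𝓛⁸`) `lemma58_scale_of_norm_le` is literally the landed
  `RepairGapLemma58Premise.lemma58_of_norm_le_pow15` (not restated here).

READING (GAP G-31 / REQSIDE (6), as-typed): the (A)-exponent the main terms consume is the scale functional
`2x_P − 3`, an equivalence of shape at each `x_P`; `15` is its value at the printed `x_P = 9`, `13` at `x_P = 8`, `1` at
`x_P = 2`. Where the remaining `𝓛^{−(E−(2x_P−3))}` of (A) is consumed (Prop. 2.2's exceptional-set route,
`ExpTuple.budgetS0_2000`) is not this file's subject. Theorems only; no definition, no named fact; nothing about (A).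

## References

* Y. Zhang, arXiv:2211.02515v1 (2022), §5 Lemma 5.8 (p. 11); §2 (2.6), (2.10); Assumption (A) p. 4.
  [cite: Zhang2022LandauSiegel, §5, Lemma 5.8; §2 (2.6), (2.10)]
-/

noncomputable section

open Complex Real

namespace Literature.NumberTheory.LFunctions.Zhang2022.Repair.Gap

open Literature.NumberTheory.LFunctions.Zhang2022.Lemma58 (norm_taylor_two_remainder_le)
open Literature.NumberTheory.LFunctions.Zhang2022.Repair.Bed (AssumptionAWith)

/-! ## Sufficiency at scale `x`: `‖L(1,χ)‖ ≤ 𝓛^{−(2x−3)}` gives Lemma 5.8 on `‖s−1‖ ≤ Kπ𝓛^{−x}` -/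

/-- **Lemma 5.8 at scale exponent `x` from the premise `‖L(1,χ)‖ ≤ 𝓛^{−(2x−3)}`** (`x ≥ 2` natural, `log D ≥ 3`,
`χ` primitive, range `‖s−1‖ ≤ Kπ𝓛^{−x}` with `Kπ ≤ 𝓛^{x−1}`; at `log P = 𝓛^{x}` this range is `‖s−1‖ ≤ Kα`):
`‖L(s,χ) − L′(1,χ)(s−1)‖ ≤ (1 + 16e^{9/2}π²K²)·𝓛^{−(2x−3)}`. The tree's Taylor step
(`Lemma58.norm_taylor_two_remainder_le`) with the scale left free: remainder `8e^{9/2}(1+𝓛)𝓛²(Kπ𝓛^{−x})² ≤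
16e^{9/2}π²K²𝓛^{3−2x}`. [cite: Zhang2022LandauSiegel, §5, Lemma 5.8] -/
theorem lemma58_scale_of_norm_le {D : ℕ} [NeZero D] (χ : DirichletCharacter ℂ D) (hprim : χ.IsPrimitive)
    (hL : 3 ≤ Real.log D) {x : ℕ} (hx : 2 ≤ x)
    (hA : ‖χ.LFunction 1‖ ≤ 1 / Real.log D ^ (2 * x - 3)) {K : ℝ}
    (hKL : K * π ≤ Real.log D ^ (x - 1)) {s : ℂ} (hs : ‖s - 1‖ ≤ K * π / Real.log D ^ x) :
    ‖χ.LFunction s - deriv χ.LFunction 1 * (s - 1)‖ ≤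
      (1 + 16 * Real.exp (9 / 2) * π ^ 2 * K ^ 2) / Real.log D ^ (2 * x - 3) := by
  set Lg : ℝ := Real.log D with hLdef
  have hL0 : 0 < Lg := by linarith
  have hL1 : 1 ≤ Lg := by linarith
  have hπ := Real.pi_pos
  -- exponent arithmetic: `x = (x−1) + 1`, `2x − 3 + 3 = 2x`
  have hx1 : x - 1 + 1 = x := by omega
  have h2x : 2 * x - 3 + 3 = 2 * x := by omega
  -- the disc `‖s−1‖ ≤ Kπ𝓛^{−x}` is inside `‖s−1‖ ≤ 1/𝓛`
  have hs1 : ‖s - 1‖ ≤ 1 / Real.log D := by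
    rw [← hLdef]
    refine hs.trans ?_
    rw [div_le_div_iff₀ (by positivity) hL0]
    calc K * π * Lg ≤ Lg ^ (x - 1) * Lg := mul_le_mul_of_nonneg_right hKL hL0.le
      _ = Lg ^ (x - 1 + 1) := by rw [pow_succ]
      _ = 1 * Lg ^ x := by rw [hx1, one_mul]
  have hrem := norm_taylor_two_remainder_le χ hL hprim hs1
  rw [← hLdef] at hrem
  -- `‖L(s) − L′(1)(s−1)‖ ≤ ‖L(1)‖ + remainder`
  have hsplit : ‖χ.LFunction s - deriv χ.LFunction 1 * (s - 1)‖ ≤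
      ‖χ.LFunction 1‖ + ‖χ.LFunction s - χ.LFunction 1 - deriv χ.LFunction 1 * (s - 1)‖ := by
    have := norm_add_le (χ.LFunction 1) (χ.LFunction s - χ.LFunction 1 - deriv χ.LFunction 1 * (s - 1))
    rw [show χ.LFunction 1 + (χ.LFunction s - χ.LFunction 1 - deriv χ.LFunction 1 * (s - 1)) =
      χ.LFunction s - deriv χ.LFunction 1 * (s - 1) by ring] at this
    exact this
  have hE := Real.exp_pos (9 / 2)
  -- `‖s−1‖² ≤ K²π²/𝓛^{2x}` and `(1+𝓛)𝓛² ≤ 2𝓛³`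
  have hs2 : ‖s - 1‖ ^ 2 ≤ (K * π) ^ 2 / (Lg ^ x) ^ 2 := by
    rw [← div_pow]
    exact pow_le_pow_left₀ (norm_nonneg _) hs 2
  have hpow2x : (Lg ^ x) ^ 2 = Lg ^ (2 * x - 3) * Lg ^ 3 := by
    rw [← pow_mul, ← pow_add, h2x, mul_comm]
  have hrem' : ‖χ.LFunction s - χ.LFunction 1 - deriv χ.LFunction 1 * (s - 1)‖ ≤
      16 * Real.exp (9 / 2) * π ^ 2 * K ^ 2 / Lg ^ (2 * x - 3) := by
    refine hrem.trans ?_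
    have h1L : 1 + Lg ≤ 2 * Lg := by linarith
    have hL3 : 0 < Lg ^ 3 := pow_pos hL0 3
    have hL2x : 0 < Lg ^ (2 * x - 3) := pow_pos hL0 _
    calc 8 * Real.exp (9 / 2) * (1 + Lg) * Lg ^ 2 * ‖s - 1‖ ^ 2
        ≤ 8 * Real.exp (9 / 2) * (2 * Lg) * Lg ^ 2 * ((K * π) ^ 2 / (Lg ^ x) ^ 2) := by gcongr
      _ = 16 * Real.exp (9 / 2) * π ^ 2 * K ^ 2 * (Lg ^ 3 / (Lg ^ (2 * x - 3) * Lg ^ 3)) := by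
          rw [hpow2x]; ring
      _ = 16 * Real.exp (9 / 2) * π ^ 2 * K ^ 2 / Lg ^ (2 * x - 3) := by
          rw [mul_comm (Lg ^ (2 * x - 3)) (Lg ^ 3), ← div_div, div_self hL3.ne']
          ring
  calc ‖χ.LFunction s - deriv χ.LFunction 1 * (s - 1)‖
      ≤ ‖χ.LFunction 1‖ + ‖χ.LFunction s - χ.LFunction 1 - deriv χ.LFunction 1 * (s - 1)‖ := hsplit
    _ ≤ 1 / Lg ^ (2 * x - 3) + 16 * Real.exp (9 / 2) * π ^ 2 * K ^ 2 / Lg ^ (2 * x - 3) :=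
        add_le_add hA hrem'
    _ = (1 + 16 * Real.exp (9 / 2) * π ^ 2 * K ^ 2) / Lg ^ (2 * x - 3) := by rw [hLdef]; ring

/-! ## Necessity at scale `x`: the conclusion forces `‖L(1,χ)‖ = O(𝓛^{−(2x−3)})` -/

/-- **The exponent `2x − 3` is the minimum the passage can consume at scale `x`**: if the conclusion of Lemma 5.8
holds with constant `C` and rate `𝓛^{−n}` on any range `‖s−1‖ ≤ r` with `r ≥ 0`, then `‖L(1,χ)‖ ≤ C𝓛^{−n}` (take
`s = 1`). With `lemma58_scale_of_norm_le` (`n = 2x − 3`): at each scale the Lemma 5.8 step closes under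
`‖L(1,χ)‖ ≤ 𝓛^{−(2x−3)}` and under no premise of weaker order — «`E ≥ 2x_P − 3`» is an equivalence of shape.
[cite: Zhang2022LandauSiegel, §5, Lemma 5.8] -/
theorem norm_LFunction_one_le_of_lemma58_scale {D : ℕ} [NeZero D] (χ : DirichletCharacter ℂ D)
    {r C : ℝ} {n : ℕ} (hr : 0 ≤ r)
    (h : ∀ s : ℂ, ‖s - 1‖ ≤ r →
      ‖χ.LFunction s - deriv χ.LFunction 1 * (s - 1)‖ ≤ C / Real.log D ^ n) :
    ‖χ.LFunction 1‖ ≤ C / Real.log D ^ n := by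
  have h1 := h 1 (by simpa using hr)
  simpa using h1

/-! ## The exponent form at scale `x`: every `E ≥ 2x − 3` suffices -/

/-- **Lemma 5.8 at scale `x` from Assumption (A) with ANY exponent `E ≥ 2x − 3`** (`Repair.Bed.AssumptionAWith E D χ :
‖L(1,χ)‖ < (log D)^{−E}`; printed `E = 2022`, `x = 9`): for `log D ≥ 3`, `(log D)^{−E} ≤ (log D)^{−(2x−3)}`. The kernel
form of the LP-3 / `ExpTuple` main-order constraint «`E ≥ 2·x_P − 3`», derived rather than read.
[cite: Zhang2022LandauSiegel, §5, Lemma 5.8] -/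
theorem lemma58_scale_of_assumptionAWith {D : ℕ} [NeZero D] (χ : DirichletCharacter ℂ D)
    (hprim : χ.IsPrimitive) (hL : 3 ≤ Real.log D) {x : ℕ} (hx : 2 ≤ x) {E : ℝ}
    (hE : ((2 * x - 3 : ℕ) : ℝ) ≤ E) (hA : AssumptionAWith E D χ) {K : ℝ}
    (hKL : K * π ≤ Real.log D ^ (x - 1)) {s : ℂ} (hs : ‖s - 1‖ ≤ K * π / Real.log D ^ x) :
    ‖χ.LFunction s - deriv χ.LFunction 1 * (s - 1)‖ ≤
      (1 + 16 * Real.exp (9 / 2) * π ^ 2 * K ^ 2) / Real.log D ^ (2 * x - 3) := by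
  refine lemma58_scale_of_norm_le χ hprim hL hx ?_ hKL hs
  unfold AssumptionAWith at hA
  have hL1 : 1 ≤ Real.log D := by linarith
  have hpow : Real.log D ^ (((2 * x - 3 : ℕ) : ℝ)) ≤ Real.log D ^ E :=
    Real.rpow_le_rpow_of_exponent_le hL1 hE
  have hpos : (0 : ℝ) < Real.log D ^ (((2 * x - 3 : ℕ) : ℝ)) := Real.rpow_pos_of_pos (by linarith) _
  have hle : 1 / Real.log D ^ E ≤ 1 / Real.log D ^ (((2 * x - 3 : ℕ) : ℝ)) :=
    one_div_le_one_div_of_le hpos hpow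
  rw [Real.rpow_natCast] at hle
  exact hA.le.trans hle

/-- **The scale law as a two-sided statement at each `x ≥ 2`** (packaging of the two directions, `K = 10` = the
printed range `‖s−1‖ ≤ 10α`, for `log D` large enough that `10π ≤ 𝓛^{x−1}`): the Lemma 5.8 conclusion with rate
`𝓛^{−(2x−3)}` on `‖s−1‖ ≤ 10π𝓛^{−x}` holds for SOME constant iff `‖L(1,χ)‖ ≤ C′𝓛^{−(2x−3)}` for SOME constant — both
directions with explicit constants (`C ↦ C`, `C′ ↦ C′ + 1600e^{9/2}π²`). [cite: Zhang2022LandauSiegel, §5, Lemma 5.8] -/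
theorem lemma58_scale_iff {D : ℕ} [NeZero D] (χ : DirichletCharacter ℂ D) (hprim : χ.IsPrimitive)
    (hL : 3 ≤ Real.log D) {x : ℕ} (hx : 2 ≤ x) (hKL : 10 * π ≤ Real.log D ^ (x - 1)) :
    (∃ C : ℝ, ∀ s : ℂ, ‖s - 1‖ ≤ 10 * π / Real.log D ^ x →
        ‖χ.LFunction s - deriv χ.LFunction 1 * (s - 1)‖ ≤ C / Real.log D ^ (2 * x - 3)) ↔
      ∃ C' : ℝ, ‖χ.LFunction 1‖ ≤ C' / Real.log D ^ (2 * x - 3) := by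
  constructor
  · rintro ⟨C, h⟩
    exact ⟨C, norm_LFunction_one_le_of_lemma58_scale χ (by positivity) h⟩
  · rintro ⟨C', hC'⟩
    have hL0 : 0 < Real.log D := by linarith
    have hpos : 0 < Real.log D ^ (2 * x - 3) := pow_pos hL0 _
    -- normalise the premise to `‖L(1,χ)·𝓛^{2x−3}/C'‖`-free form: scale `L(1)` is not available, so run the
    -- Taylor step directly with the premise `C'/𝓛^{2x−3}` in place of `1/𝓛^{2x−3}`
    refine ⟨C' + 16 * Real.exp (9 / 2) * π ^ 2 * 10 ^ 2, fun s hs => ?_⟩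
    set Lg : ℝ := Real.log D with hLdef
    have hL1 : 1 ≤ Lg := by linarith
    have hx1 : x - 1 + 1 = x := by omega
    have h2x : 2 * x - 3 + 3 = 2 * x := by omega
    have hs1 : ‖s - 1‖ ≤ 1 / Real.log D := by
      rw [← hLdef]
      refine hs.trans ?_
      rw [div_le_div_iff₀ (by positivity) hL0]
      calc 10 * π * Lg ≤ Lg ^ (x - 1) * Lg := mul_le_mul_of_nonneg_right hKL hL0.le
        _ = Lg ^ (x - 1 + 1) := by rw [pow_succ]
        _ = 1 * Lg ^ x := by rw [hx1, one_mul]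
    have hrem := norm_taylor_two_remainder_le χ hL hprim hs1
    rw [← hLdef] at hrem
    have hsplit : ‖χ.LFunction s - deriv χ.LFunction 1 * (s - 1)‖ ≤
        ‖χ.LFunction 1‖ + ‖χ.LFunction s - χ.LFunction 1 - deriv χ.LFunction 1 * (s - 1)‖ := by
      have := norm_add_le (χ.LFunction 1) (χ.LFunction s - χ.LFunction 1 - deriv χ.LFunction 1 * (s - 1))
      rw [show χ.LFunction 1 + (χ.LFunction s - χ.LFunction 1 - deriv χ.LFunction 1 * (s - 1)) =
        χ.LFunction s - deriv χ.LFunction 1 * (s - 1) by ring] at this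
      exact this
    have hs2 : ‖s - 1‖ ^ 2 ≤ (10 * π) ^ 2 / (Lg ^ x) ^ 2 := by
      rw [← div_pow]
      exact pow_le_pow_left₀ (norm_nonneg _) hs 2
    have hpow2x : (Lg ^ x) ^ 2 = Lg ^ (2 * x - 3) * Lg ^ 3 := by
      rw [← pow_mul, ← pow_add, h2x, mul_comm]
    have hE := Real.exp_pos (9 / 2)
    have hrem' : ‖χ.LFunction s - χ.LFunction 1 - deriv χ.LFunction 1 * (s - 1)‖ ≤
        16 * Real.exp (9 / 2) * π ^ 2 * 10 ^ 2 / Lg ^ (2 * x - 3) := by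
      refine hrem.trans ?_
      have h1L : 1 + Lg ≤ 2 * Lg := by linarith
      have hL3 : 0 < Lg ^ 3 := pow_pos hL0 3
      calc 8 * Real.exp (9 / 2) * (1 + Lg) * Lg ^ 2 * ‖s - 1‖ ^ 2
          ≤ 8 * Real.exp (9 / 2) * (2 * Lg) * Lg ^ 2 * ((10 * π) ^ 2 / (Lg ^ x) ^ 2) := by gcongr
        _ = 16 * Real.exp (9 / 2) * π ^ 2 * 10 ^ 2 * (Lg ^ 3 / (Lg ^ (2 * x - 3) * Lg ^ 3)) := by
            rw [hpow2x]; ring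
        _ = 16 * Real.exp (9 / 2) * π ^ 2 * 10 ^ 2 / Lg ^ (2 * x - 3) := by
            rw [mul_comm (Lg ^ (2 * x - 3)) (Lg ^ 3), ← div_div, div_self hL3.ne']
            ring
    calc ‖χ.LFunction s - deriv χ.LFunction 1 * (s - 1)‖
        ≤ ‖χ.LFunction 1‖ + ‖χ.LFunction s - χ.LFunction 1 - deriv χ.LFunction 1 * (s - 1)‖ := hsplit
      _ ≤ C' / Lg ^ (2 * x - 3) + 16 * Real.exp (9 / 2) * π ^ 2 * 10 ^ 2 / Lg ^ (2 * x - 3) :=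
          add_le_add hC' hrem'
      _ = (C' + 16 * Real.exp (9 / 2) * π ^ 2 * 10 ^ 2) / Lg ^ (2 * x - 3) := by ring

/-! ## (rev 2) The scale law with UNIFORM constants -/

/-- **The scale law as a two-sided statement with constants UNIFORM over moduli and characters** (rev 2, answering the
referee's note on `lemma58_scale_iff`, whose constants are existential per `(D, χ)` and hence carry no uniform content).
Fix `x ≥ 2` and any class of pairs `(D, χ)` with `χ` primitive, `log D ≥ 3` and `10π ≤ (log D)^{x−1}` (a predicate `P`);
then: ONE constant `C` gives the Lemma 5.8 conclusion with rate `𝓛^{−(2x−3)}` on `‖s−1‖ ≤ 10π𝓛^{−x}` for EVERY pair in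
the class **iff** ONE constant `C′` gives `‖L(1,χ)‖ ≤ C′𝓛^{−(2x−3)}` for every pair in the class (`C ↦ C`,
`C′ ↦ C′ + 1600e^{9/2}π²`). The right side is a Siegel-type premise of exponent `2x − 3` on the class; the left side is the
door's output on the class — «`E ≥ 2x_P − 3`» as an equivalence between uniform statements.
[cite: Zhang2022LandauSiegel, §5, Lemma 5.8] -/
theorem lemma58_scale_iff_uniform {x : ℕ} (hx : 2 ≤ x)
    (P : (D : ℕ) → [NeZero D] → DirichletCharacter ℂ D → Prop)
    (hP : ∀ (D : ℕ) [NeZero D] (χ : DirichletCharacter ℂ D), P D χ →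
      χ.IsPrimitive ∧ 3 ≤ Real.log D ∧ 10 * π ≤ Real.log D ^ (x - 1)) :
    (∃ C : ℝ, ∀ (D : ℕ) [NeZero D] (χ : DirichletCharacter ℂ D), P D χ →
        ∀ s : ℂ, ‖s - 1‖ ≤ 10 * π / Real.log D ^ x →
          ‖χ.LFunction s - deriv χ.LFunction 1 * (s - 1)‖ ≤ C / Real.log D ^ (2 * x - 3)) ↔
      ∃ C' : ℝ, ∀ (D : ℕ) [NeZero D] (χ : DirichletCharacter ℂ D), P D χ →
        ‖χ.LFunction 1‖ ≤ C' / Real.log D ^ (2 * x - 3) := by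
  constructor
  · rintro ⟨C, h⟩
    refine ⟨C, fun D _ χ hPD => ?_⟩
    exact norm_LFunction_one_le_of_lemma58_scale χ (by positivity) (h D χ hPD)
  · rintro ⟨C', h⟩
    refine ⟨C' + 16 * Real.exp (9 / 2) * π ^ 2 * 10 ^ 2, fun D _ χ hPD s hs => ?_⟩
    obtain ⟨hprim, hL, hKL⟩ := hP D χ hPD
    -- the explicit Taylor estimate with `‖L(1,χ)‖ ≤ C'/𝓛^{2x−3}` in place of `1/𝓛^{2x−3}`
    have hL0 : 0 < Real.log D := by linarith
    set Lg : ℝ := Real.log D with hLdef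
    have hx1 : x - 1 + 1 = x := by omega
    have h2x : 2 * x - 3 + 3 = 2 * x := by omega
    have hs1 : ‖s - 1‖ ≤ 1 / Real.log D := by
      rw [← hLdef]
      refine hs.trans ?_
      rw [div_le_div_iff₀ (by positivity) hL0]
      calc 10 * π * Lg ≤ Lg ^ (x - 1) * Lg := mul_le_mul_of_nonneg_right hKL hL0.le
        _ = Lg ^ (x - 1 + 1) := by rw [pow_succ]
        _ = 1 * Lg ^ x := by rw [hx1, one_mul]
    have hrem := norm_taylor_two_remainder_le χ hL hprim hs1
    rw [← hLdef] at hrem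
    have hsplit : ‖χ.LFunction s - deriv χ.LFunction 1 * (s - 1)‖ ≤
        ‖χ.LFunction 1‖ + ‖χ.LFunction s - χ.LFunction 1 - deriv χ.LFunction 1 * (s - 1)‖ := by
      have := norm_add_le (χ.LFunction 1) (χ.LFunction s - χ.LFunction 1 - deriv χ.LFunction 1 * (s - 1))
      rw [show χ.LFunction 1 + (χ.LFunction s - χ.LFunction 1 - deriv χ.LFunction 1 * (s - 1)) =
        χ.LFunction s - deriv χ.LFunction 1 * (s - 1) by ring] at this
      exact this
    have hs2 : ‖s - 1‖ ^ 2 ≤ (10 * π) ^ 2 / (Lg ^ x) ^ 2 := by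
      rw [← div_pow]
      exact pow_le_pow_left₀ (norm_nonneg _) hs 2
    have hpow2x : (Lg ^ x) ^ 2 = Lg ^ (2 * x - 3) * Lg ^ 3 := by
      rw [← pow_mul, ← pow_add, h2x, mul_comm]
    have hE := Real.exp_pos (9 / 2)
    have hrem' : ‖χ.LFunction s - χ.LFunction 1 - deriv χ.LFunction 1 * (s - 1)‖ ≤
        16 * Real.exp (9 / 2) * π ^ 2 * 10 ^ 2 / Lg ^ (2 * x - 3) := by
      refine hrem.trans ?_
      have h1L : 1 + Lg ≤ 2 * Lg := by linarith
      have hL3 : 0 < Lg ^ 3 := pow_pos hL0 3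
      calc 8 * Real.exp (9 / 2) * (1 + Lg) * Lg ^ 2 * ‖s - 1‖ ^ 2
          ≤ 8 * Real.exp (9 / 2) * (2 * Lg) * Lg ^ 2 * ((10 * π) ^ 2 / (Lg ^ x) ^ 2) := by gcongr
        _ = 16 * Real.exp (9 / 2) * π ^ 2 * 10 ^ 2 * (Lg ^ 3 / (Lg ^ (2 * x - 3) * Lg ^ 3)) := by
            rw [hpow2x]; ring
        _ = 16 * Real.exp (9 / 2) * π ^ 2 * 10 ^ 2 / Lg ^ (2 * x - 3) := by
            rw [mul_comm (Lg ^ (2 * x - 3)) (Lg ^ 3), ← div_div, div_self hL3.ne']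
            ring
    calc ‖χ.LFunction s - deriv χ.LFunction 1 * (s - 1)‖
        ≤ ‖χ.LFunction 1‖ + ‖χ.LFunction s - χ.LFunction 1 - deriv χ.LFunction 1 * (s - 1)‖ := hsplit
      _ ≤ C' / Lg ^ (2 * x - 3) + 16 * Real.exp (9 / 2) * π ^ 2 * 10 ^ 2 / Lg ^ (2 * x - 3) :=
          add_le_add (h D χ hPD) hrem'
      _ = (C' + 16 * Real.exp (9 / 2) * π ^ 2 * 10 ^ 2) / Lg ^ (2 * x - 3) := by ring

end Literature.NumberTheory.LFunctions.Zhang2022.Repair.Gap
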